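/-
Copyright (c) 2026. Released under Apache 2.0 license.
-/
import Mathlib
import Literature.NumberTheory.EllipticCurves.HeightDensityFullBSDOffS
import Literature.NumberTheory.EllipticCurves.TwoMultiplicativePrimesDensity
import HarnessLib

/-!
# Row (ii-1) of `PERCENT-FULL.md` with the two-exact-primes sieve (F3) DISCHARGED

`HeightDensityFullBSDOffS` proves the transfer theorem
`HeightDensityGE.rankLeOne_and_fullBSDOffSgoPrime` of row (ii-1) of the `pub-bsdpct` bundle's
`PERCENT-FULL.md` with the sieve input (F3) — naive-height density one of pairs `(A, B)` with two
distinct primes `ℓ₁, ℓ₂ ≥ 5`, `ord_{ℓᵢ}(4A³ + 27B²) = 1` — as the explicit hypothesis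
`hF3 : HeightDensityGE TwoOrdOnePrimes 1`.

`TwoMultiplicativePrimesDensity` PROVES that sieve in the kernel
(`heightDensityGE_twoPrimes_ordDisc_eq_one`: the same two primes, with the extra information
`ℓᵢ ∤ A`), i.e. the second property of [BSZ14, Lemma 20] in the `p`-uniform form of its printed proof.

This file joins the two: `heightDensityGE_twoOrdOnePrimes_one : HeightDensityGE TwoOrdOnePrimes 1`
(drop the conjuncts `ℓᵢ ∤ A`), and the transfer theorem / its two instances WITHOUT the hypothesis
`hF3`. What remains named in the statements: Duke's density-zero theorem (F1), `bsd.S30`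
(Skinner–Urban + Kato, rank 0), W. Zhang's Theorem 7.3 (rank 1), modularity, Gross–Zagier–Kolyvagin,
and the rank-part density input (`bhargava_skinner_zhang` at the printed `.6648`, or Theorem A′ of the
bundle at `c_rank = 3059480216411717 / 4576171406400000` as a hypothesis — the package
`BSDPercentage` is not part of this tree). No new definitions; no named facts.

[cite: BhargavaSkinnerZhang2014, Lemma 20 (proof, p. 10); Theorem 27]
-/

open WeierstrassCurve Literature.NumberTheory.EllipticCurves

namespace Literature.NumberTheory.EllipticCurves

open BhargavaSkinnerZhang2014

/-- **(F3) with `k = 2`, discharged.** Naive-height (lower) density one of pairs `(A, B)` admit two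
distinct primes `ℓ₁, ℓ₂ ≥ 5` with `ord_{ℓᵢ}(4A³ + 27B²) = 1` — the hypothesis `hF3` of
`HeightDensityGE.rankLeOne_and_fullBSDOffSgoPrime`, obtained from the kernel sieve
`heightDensityGE_twoPrimes_ordDisc_eq_one` of `TwoMultiplicativePrimesDensity` by forgetting `ℓᵢ ∤ A`.
[cite: BhargavaSkinnerZhang2014, Lemma 20 (proof, p. 10)] -/
theorem heightDensityGE_twoOrdOnePrimes_one : HeightDensityGE TwoOrdOnePrimes 1 := by
  refine HeightDensityGE.mono ?_ heightDensityGE_twoPrimes_ordDisc_eq_one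
  rintro AB ⟨ℓ₁, ℓ₂, h₁, h₂, h5₁, h5₂, hne, ⟨-, hv₁⟩, ⟨-, hv₂⟩⟩
  exact ⟨ℓ₁, ℓ₂, h₁, h₂, h5₁, h5₂, hne, hv₁, hv₂⟩

/-- **Row (ii-1), transfer theorem with (F3) discharged.** For every rank-part constant `c`:
if the rank part of BSD (`SatisfiesBSDRankLeOne`) holds for a naive-height density `≥ c` of
`E_{A,B}`, then — granting Duke's theorem (F1), `bsd.S30`, W. Zhang's Theorem 7.3, modularity and
Gross–Zagier–Kolyvagin as named — 'rank part ∧ `BSD(E, p)` at every prime `p ≥ 5` of good ordinary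
reduction outside `Z⋆(E)`' (`FullBSDOffSgoPrime`) holds for a density `≥ c` as well. This is
`HeightDensityGE.rankLeOne_and_fullBSDOffSgoPrime` with `hF3 := heightDensityGE_twoOrdOnePrimes_one`.
[cite: BhargavaSkinnerZhang2014, Theorem 27; Lemma 20] -/
theorem HeightDensityGE.rankLeOne_and_fullBSDOffSgoPrime_of_sieve
    (hD : Duke1997_exceptionalPrimes_densityZero)
    (hS30 : padicValRat_bsd_rank_zero) (hZ : WZhang2014_padicValRat_bsd_rank_one_ordinary)
    (hmod : hasEntireLFunction_rat) (hGZK : rank_eq_analyticRank_of_analyticRank_le_one)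
    {c : ℝ} (hA : HeightDensityGE SatisfiesBSDRankLeOne c) :
    HeightDensityGE (fun AB ↦ SatisfiesBSDRankLeOne AB ∧ FullBSDOffSgoPrime AB) c :=
  HeightDensityGE.rankLeOne_and_fullBSDOffSgoPrime hD heightDensityGE_twoOrdOnePrimes_one hS30 hZ
    hmod hGZK hA

/-- Row (ii-1) at the PRINTED Bhargava–Skinner–Zhang constant `.6648` (`bhargava_skinner_zhang`,
Theorem 27 as a named statement), (F3) discharged. A remark, not a number of the bundle (the bundle's
audited rank-part constant is `c_rank`, next theorem). [cite: BhargavaSkinnerZhang2014, Theorem 27] -/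
theorem heightDensityGE_rankLeOne_and_fullBSDOffSgoPrime_of_bsz_of_sieve
    (hBSZ : bhargava_skinner_zhang) (hD : Duke1997_exceptionalPrimes_densityZero)
    (hS30 : padicValRat_bsd_rank_zero) (hZ : WZhang2014_padicValRat_bsd_rank_one_ordinary)
    (hmod : hasEntireLFunction_rat) (hGZK : rank_eq_analyticRank_of_analyticRank_le_one) :
    HeightDensityGE (fun AB ↦ SatisfiesBSDRankLeOne AB ∧ FullBSDOffSgoPrime AB) 0.6648 :=
  HeightDensityGE.rankLeOne_and_fullBSDOffSgoPrime_of_sieve hD hS30 hZ hmod hGZK hBSZ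

/-- **Row (ii-1) of `PERCENT-FULL.md` at `c_rank = 3059480216411717 / 4576171406400000 = 0.66856…`,
(F3) discharged**: the rank-part conclusion of Theorem A′ of the `pub-bsdpct` bundle enters as the
hypothesis `hA` (its package is not in this tree); everything else named is a published theorem
((F1) Duke 1997; `bsd.S30`; W. Zhang 2014 Thm 7.3; modularity; Gross–Zagier–Kolyvagin).
[cite: BhargavaSkinnerZhang2014, Theorem 27; Lemma 20] -/
theorem heightDensityGE_rankLeOne_and_fullBSDOffSgoPrime_cRank_of_sieve
    (hA : HeightDensityGE SatisfiesBSDRankLeOne (3059480216411717 / 4576171406400000))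
    (hD : Duke1997_exceptionalPrimes_densityZero)
    (hS30 : padicValRat_bsd_rank_zero) (hZ : WZhang2014_padicValRat_bsd_rank_one_ordinary)
    (hmod : hasEntireLFunction_rat) (hGZK : rank_eq_analyticRank_of_analyticRank_le_one) :
    HeightDensityGE (fun AB ↦ SatisfiesBSDRankLeOne AB ∧ FullBSDOffSgoPrime AB)
      (3059480216411717 / 4576171406400000) :=
  HeightDensityGE.rankLeOne_and_fullBSDOffSgoPrime_of_sieve hD hS30 hZ hmod hGZK hA

end Literature.NumberTheory.EllipticCurves
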